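import Summits.CriticalPhenomena.SAWScalingLimit.Theses.SAWTotalPositivity

/-!
# Negative-side results for the crux `SAWTotalPositivity.TPToTraversalBound` (stmt-CriticalPhenomena-10687):
a certified inhabitant of `SAW.IsEndpointApprox` with a MESOSCOPICALLY INTERIOR start

Refuter `cdisprove` (standing adversary); work file
`Summits/CriticalPhenomena/SAWScalingLimit/Cruxes/TPToTraversalBound/Disproof.lean` §6 (finding F2 v).

`exists_isEndpointApprox_deepStart`: in the unit disc there is an endpoint approximation `(a_δ, b_δ)` (in the
sense of `SAW.IsEndpointApprox DobrushinDomain.unitDisc`) such that the open ball of radius `√δ` about the mesh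
point of `a_δ` lies INSIDE the disc for every `δ ≤ 1/16`.  Hence the typed conclusion (H1) = `SAWTraversalBound`
of the crux quantifies over chordal critical SAWs whose first `√δ/δ → ∞` lattice steps see no boundary:
start-centred shells `D(a_δ; δ, √δ)` of ratio `ρ/R = √δ → 0` are in scope, and there whole-plane endpoint
exponents apply (one return to the start = 3 legs at a point, `x₃ - x₁ = 3/2 < 2` in the O(n→0) Coulomb-gas
bookkeeping), so a threshold `k ≤ 3` near the marked points is NOT available to a prover of (H1); `k = 4`
(two returns, `x₅ - x₁ = 9/2 > 2`) is the predicted minimum.  Convergence rates as slow as `δ^{0.01}` are equally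
admissible.  Moral for crux-plan: `IsEndpointApprox` is a germ condition at `0⁺` with no rate and no
boundary-proximity requirement.
-/

namespace Summit.CriticalPhenomena.SAWScalingLimit.Theorems.TPToTraversalBound.Negative

open Summit.CriticalPhenomena.SAWScalingLimit.Theses.SAWTotalPositivity
open Literature.Probability.RandomPlanarGeometry Literature.Probability.LatticeModels MeasureTheory

section DeepStart

open Literature.Probability.RandomPlanarGeometry.SAW Literature.Probability.Percolation Filter Topology Set

/-- The lattice abscissa of the depth-`√δ` starting point: `⌈δ⁻¹⌉ - 1 - ⌈(√δ)⁻¹⌉`. -/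
noncomputable def deepIndex (δ : ℝ) : ℤ := ⌈δ⁻¹⌉ - 1 - ⌈(Real.sqrt δ)⁻¹⌉

/-- The mesh abscissa `δ · deepIndex δ` lies in `(1 - √δ - 2δ, 1 - √δ)`. [folklore] -/
theorem deepIndex_bounds {δ : ℝ} (hδ : 0 < δ) :
    1 - Real.sqrt δ - 2 * δ < δ * (deepIndex δ : ℝ) ∧ δ * (deepIndex δ : ℝ) < 1 - Real.sqrt δ := by
  have hs : 0 < Real.sqrt δ := Real.sqrt_pos.2 hδ
  have hss : Real.sqrt δ * Real.sqrt δ = δ := Real.mul_self_sqrt hδ.le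
  have h1 : (δ⁻¹ : ℝ) ≤ ⌈δ⁻¹⌉ := Int.le_ceil _
  have h2 : (⌈δ⁻¹⌉ : ℝ) < δ⁻¹ + 1 := Int.ceil_lt_add_one _
  have h3 : ((Real.sqrt δ)⁻¹ : ℝ) ≤ ⌈(Real.sqrt δ)⁻¹⌉ := Int.le_ceil _
  have h4 : (⌈(Real.sqrt δ)⁻¹⌉ : ℝ) < (Real.sqrt δ)⁻¹ + 1 := Int.ceil_lt_add_one _
  have hδinv : δ * δ⁻¹ = 1 := mul_inv_cancel₀ hδ.ne'
  have hsinv : δ * (Real.sqrt δ)⁻¹ = Real.sqrt δ := by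
    rw [eq_comm, eq_mul_inv_iff_mul_eq₀ hs.ne']; exact hss
  have e1 : 1 ≤ δ * (⌈δ⁻¹⌉ : ℝ) := by
    have := mul_le_mul_of_nonneg_left h1 hδ.le; rwa [hδinv] at this
  have e2 : δ * (⌈δ⁻¹⌉ : ℝ) < 1 + δ := by
    have := mul_lt_mul_of_pos_left h2 hδ; rwa [mul_add, hδinv, mul_one] at this
  have e3 : Real.sqrt δ ≤ δ * (⌈(Real.sqrt δ)⁻¹⌉ : ℝ) := by
    have := mul_le_mul_of_nonneg_left h3 hδ.le; rwa [hsinv] at this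
  have e4 : δ * (⌈(Real.sqrt δ)⁻¹⌉ : ℝ) < Real.sqrt δ + δ := by
    have := mul_lt_mul_of_pos_left h4 hδ; rwa [mul_add, hsinv, mul_one] at this
  have cast : (deepIndex δ : ℝ) = (⌈δ⁻¹⌉ : ℝ) - 1 - (⌈(Real.sqrt δ)⁻¹⌉ : ℝ) := by
    simp [deepIndex]
  have expand : δ * (deepIndex δ : ℝ) = δ * (⌈δ⁻¹⌉ : ℝ) - δ - δ * (⌈(Real.sqrt δ)⁻¹⌉ : ℝ) := by
    rw [cast]; ring
  rw [expand]
  constructor <;> linarith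

/-- For `δ ≤ 1/16` the mesh abscissa is in `(5/8, 1)`, in particular in the unit disc. [folklore] -/
theorem deepIndex_pos {δ : ℝ} (hδ : 0 < δ) (hδ' : δ ≤ 1 / 16) :
    5 / 8 < δ * (deepIndex δ : ℝ) ∧ δ * (deepIndex δ : ℝ) < 1 := by
  obtain ⟨h1, h2⟩ := deepIndex_bounds hδ
  have hs4 : Real.sqrt δ ≤ 1 / 4 := by
    have := Real.sqrt_le_sqrt hδ'
    rwa [show (1 / 16 : ℝ) = (1 / 4) ^ 2 by norm_num, Real.sqrt_sq (by norm_num)] at this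
  have hs0 : 0 ≤ Real.sqrt δ := Real.sqrt_nonneg _
  constructor <;> linarith

/-- CERTIFIED INHABITANT (F2 v): `IsEndpointApprox` admits, in the unit disc, a starting point at
depth `√δ ≫ δ` — the open ball of radius `√δ` about the mesh point of `a δ` lies inside the domain
for every `δ ≤ 1/16` — together with the symmetric end point.  Hence the typed (H1) quantifies
over chordal critical SAWs whose first `√δ/δ → ∞` lattice steps see no boundary: start-centred
shells `D(a_δ; δ, √δ)` have ratio `ρ/R = √δ → 0`, and there the literature's boundary-start
exponents do not apply (whole-plane endpoint exponents do: one return = 3 legs, `x₃ - x₁ = 3/2 < 2`,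
so a threshold `k ≤ 3` near the marked points is NOT available to a prover). [folklore] -/
theorem exists_isEndpointApprox_deepStart :
    ∃ a b : ℝ → Site 2, IsEndpointApprox DobrushinDomain.unitDisc a b ∧
      ∀ δ : ℝ, 0 < δ → δ ≤ 1 / 16 →
        Metric.ball (meshPoint δ (a δ)) (Real.sqrt δ) ⊆ DobrushinDomain.unitDisc.carrier := by
  /- ### arithmetic of mesh points (after SAWParafermionTightRefutation) -/
  have normSq_meshPoint : ∀ (δ : ℝ) (x : Site 2),
      Complex.normSq (meshPoint δ x) = δ ^ 2 * ((x 0 : ℝ) ^ 2 + (x 1 : ℝ) ^ 2) := by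
    intro δ x
    rw [Complex.normSq_apply, meshPoint_re, meshPoint_im]; ring
  have mem_ball_of_sq_le : ∀ {δ : ℝ} {x y : Site 2},
      meshPoint δ x ∈ Metric.ball (0 : ℂ) 1 →
      (y 0 : ℝ) ^ 2 + (y 1 : ℝ) ^ 2 ≤ (x 0 : ℝ) ^ 2 + (x 1 : ℝ) ^ 2 →
      meshPoint δ y ∈ Metric.ball (0 : ℂ) 1 := by
    intro δ x y hx h
    rw [Metric.mem_ball, dist_zero_right] at hx ⊢
    have hx2 : ‖meshPoint δ x‖ ^ 2 < 1 := by
      have := norm_nonneg (meshPoint δ x); nlinarith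
    have hy2 : ‖meshPoint δ y‖ ^ 2 ≤ ‖meshPoint δ x‖ ^ 2 := by
      rw [Complex.sq_norm, Complex.sq_norm, normSq_meshPoint, normSq_meshPoint]
      exact mul_le_mul_of_nonneg_left h (sq_nonneg δ)
    have hy1 : ‖meshPoint δ y‖ ^ 2 < 1 := hy2.trans_lt hx2
    nlinarith [norm_nonneg (meshPoint δ y)]
  /- one step towards the origin, decreasing `|x₀| + |x₁|` -/
  have exists_step : ∀ x : Site 2, x ≠ 0 →
      ∃ y : Site 2, (zdGraph 2).Adj x y ∧
        (y 0 : ℝ) ^ 2 + (y 1 : ℝ) ^ 2 ≤ (x 0 : ℝ) ^ 2 + (x 1 : ℝ) ^ 2 ∧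
        (y 0).natAbs + (y 1).natAbs < (x 0).natAbs + (x 1).natAbs := by
    intro x hx
    by_cases h0 : x 0 = 0
    · have h1 : x 1 ≠ 0 := by
        intro h1; apply hx; funext i; fin_cases i <;> simp [h0, h1]
      rcases lt_or_gt_of_ne h1 with hneg | hpos
      · refine ⟨x + Pi.single 1 1, (zdGraph_adj_iff _ _).2 ⟨1, Or.inl rfl⟩, ?_, ?_⟩
        · simp only [Pi.add_apply, Pi.single_eq_same, Pi.single_eq_of_ne (zero_ne_one), add_zero,
            Int.cast_add, Int.cast_one]
          have : (x 1 : ℝ) ≤ -1 := by exact_mod_cast Int.le_sub_one_of_lt hneg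
          nlinarith
        · simp only [Pi.add_apply, Pi.single_eq_same, Pi.single_eq_of_ne (zero_ne_one), add_zero]
          omega
      · refine ⟨x - Pi.single 1 1, (zdGraph_adj_iff _ _).2 ⟨1, Or.inr (by simp)⟩, ?_, ?_⟩
        · simp only [Pi.sub_apply, Pi.single_eq_same, Pi.single_eq_of_ne (zero_ne_one), sub_zero,
            Int.cast_sub, Int.cast_one]
          have : (1 : ℝ) ≤ x 1 := by exact_mod_cast hpos
          nlinarith
        · simp only [Pi.sub_apply, Pi.single_eq_same, Pi.single_eq_of_ne (zero_ne_one), sub_zero]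
          omega
    · rcases lt_or_gt_of_ne h0 with hneg | hpos
      · refine ⟨x + Pi.single 0 1, (zdGraph_adj_iff _ _).2 ⟨0, Or.inl rfl⟩, ?_, ?_⟩
        · simp only [Pi.add_apply, Pi.single_eq_same, Pi.single_eq_of_ne (one_ne_zero), add_zero,
            Int.cast_add, Int.cast_one]
          have : (x 0 : ℝ) ≤ -1 := by exact_mod_cast Int.le_sub_one_of_lt hneg
          nlinarith
        · simp only [Pi.add_apply, Pi.single_eq_same, Pi.single_eq_of_ne (one_ne_zero), add_zero]
          omega
      · refine ⟨x - Pi.single 0 1, (zdGraph_adj_iff _ _).2 ⟨0, Or.inr (by simp)⟩, ?_, ?_⟩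
        · simp only [Pi.sub_apply, Pi.single_eq_same, Pi.single_eq_of_ne (one_ne_zero), sub_zero,
            Int.cast_sub, Int.cast_one]
          have : (1 : ℝ) ≤ x 0 := by exact_mod_cast hpos
          nlinarith
        · simp only [Pi.sub_apply, Pi.single_eq_same, Pi.single_eq_of_ne (one_ne_zero), sub_zero]
          omega
  /- ### the mesh graph of the unit disc is connected -/
  have meshPoint_zero : ∀ δ : ℝ, meshPoint δ (0 : Site 2) = 0 :=
    fun δ => Complex.ext (by simp) (by simp)
  have zero_mem : ∀ δ : ℝ, (0 : Site 2) ∈ meshVertices (Metric.ball (0 : ℂ) 1) δ := by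
    intro δ; simp [meshVertices, meshPoint_zero δ]
  have meshGraph_adj_of : ∀ {δ : ℝ} {x y : Site 2}, (zdGraph 2).Adj x y →
      meshPoint δ x ∈ Metric.ball (0 : ℂ) 1 → meshPoint δ y ∈ Metric.ball (0 : ℂ) 1 →
      (meshGraph (Metric.ball (0 : ℂ) 1) δ).Adj x y := fun hxy hx hy =>
    meshGraph_adj_iff.2 ⟨hxy, ((convex_ball (0 : ℂ) 1).segment_subset hx hy).trans subset_closure⟩
  have reachable_zero : ∀ (δ : ℝ) (n : ℕ) (x : Site 2)
      (hx : x ∈ meshVertices (Metric.ball (0 : ℂ) 1) δ), (x 0).natAbs + (x 1).natAbs = n →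
      (meshVertexGraph (Metric.ball (0 : ℂ) 1) δ).Reachable ⟨x, hx⟩ ⟨0, zero_mem δ⟩ := by
    intro δ n
    induction n using Nat.strong_induction_on with
    | _ n ih =>
      intro x hx hn
      by_cases h0 : x = 0
      · subst h0; rfl
      obtain ⟨y, hadj, hle, hlt⟩ := exists_step x h0
      have hy : y ∈ meshVertices (Metric.ball (0 : ℂ) 1) δ := mem_ball_of_sq_le hx hle
      have h1 : (meshVertexGraph (Metric.ball (0 : ℂ) 1) δ).Adj ⟨x, hx⟩ ⟨y, hy⟩ := by
        simp only [SimpleGraph.comap_adj, Function.Embedding.subtype_apply]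
        exact meshGraph_adj_of hadj hx hy
      exact h1.reachable.trans (ih _ (hn ▸ hlt) y hy rfl)
  have preconnected : ∀ δ : ℝ, (meshVertexGraph (Metric.ball (0 : ℂ) 1) δ).Preconnected := by
    intro δ u v
    exact (reachable_zero δ _ u.1 u.2 rfl).trans (reachable_zero δ _ v.1 v.2 rfl).symm
  /- for the disc, `Ω_δ` is all of `δℤ² ∩ 𝔻` -/
  have mem_meshDomain : ∀ {δ : ℝ} {x : Site 2}, x ∈ meshVertices (Metric.ball (0 : ℂ) 1) δ →
      x ∈ meshDomain (Metric.ball (0 : ℂ) 1) δ := by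
    intro δ x hx
    have hsub := (preconnected δ).subsingleton_connectedComponent
    simp only [meshDomain, Set.mem_iUnion, Set.mem_image]
    refine ⟨(meshVertexGraph (Metric.ball (0 : ℂ) 1) δ).connectedComponentMk ⟨x, hx⟩,
      fun C' => ?_, ⟨x, hx⟩, ?_, rfl⟩
    · rw [Subsingleton.elim C'
        ((meshVertexGraph (Metric.ball (0 : ℂ) 1) δ).connectedComponentMk ⟨x, hx⟩)]
    · rw [SimpleGraph.ConnectedComponent.mem_supp_iff]
  have reachable_of_mem : ∀ {δ : ℝ} {x y : Site 2}, meshPoint δ x ∈ Metric.ball (0 : ℂ) 1 →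
      meshPoint δ y ∈ Metric.ball (0 : ℂ) 1 →
      (discreteDomainGraph (Metric.ball (0 : ℂ) 1) δ).Reachable x y := by
    intro δ x y hx hy
    let hom : meshVertexGraph (Metric.ball (0 : ℂ) 1) δ →g
        discreteDomainGraph (Metric.ball (0 : ℂ) 1) δ :=
      { toFun := Subtype.val
        map_rel' := fun {u v} h =>
          discreteDomainGraph_adj_iff.2 ⟨h, mem_meshDomain u.2, mem_meshDomain v.2⟩ }
    exact (preconnected δ ⟨x, hx⟩ ⟨y, hy⟩).map hom
  /- ### the deep endpoints -/
  have meshPoint_vec : ∀ (δ : ℝ) (m : ℤ), meshPoint δ ![m, 0] = ((δ * m : ℝ) : ℂ) :=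
    fun δ m => Complex.ext (by simp) (by simp)
  have meshPoint_neg : ∀ (δ : ℝ) (m : ℤ), meshPoint δ ![-m, 0] = -meshPoint δ ![m, 0] := by
    intro δ m; rw [meshPoint_vec, meshPoint_vec]; push_cast; ring
  have deep_mem : ∀ {δ : ℝ}, 0 < δ → δ ≤ 1 / 16 →
      meshPoint δ ![deepIndex δ, 0] ∈ Metric.ball (0 : ℂ) 1 := by
    intro δ hδ hδ'
    rw [meshPoint_vec, Metric.mem_ball, dist_zero_right, Complex.norm_real, Real.norm_eq_abs,
      abs_lt]
    obtain ⟨h1, h2⟩ := deepIndex_pos hδ hδ'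
    constructor <;> linarith
  have deep_neg_mem : ∀ {δ : ℝ}, 0 < δ → δ ≤ 1 / 16 →
      meshPoint δ ![-deepIndex δ, 0] ∈ Metric.ball (0 : ℂ) 1 := by
    intro δ hδ hδ'
    rw [meshPoint_neg, Metric.mem_ball, dist_zero_right, norm_neg, ← dist_zero_right,
      ← Metric.mem_ball]
    exact deep_mem hδ hδ'
  have dist_deep_lt : ∀ {δ : ℝ}, 0 < δ →
      dist (meshPoint δ ![deepIndex δ, 0]) 1 < Real.sqrt δ + 2 * δ := by
    intro δ hδ
    rw [meshPoint_vec, ← Complex.ofReal_one, Complex.dist_eq, ← Complex.ofReal_sub,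
      Complex.norm_real, Real.norm_eq_abs, abs_lt]
    obtain ⟨h1, h2⟩ := deepIndex_bounds hδ
    have hs0 : 0 ≤ Real.sqrt δ := Real.sqrt_nonneg _
    constructor <;> linarith
  have pt_zero : DobrushinDomain.unitDisc.pt 0 = 1 := by
    simp [MarkedDomain.pt, DobrushinDomain.unitDisc, JordanDomain.unitDisc, circleMap]
  have pt_one : DobrushinDomain.unitDisc.pt 1 = -1 := by
    simp [MarkedDomain.pt, DobrushinDomain.unitDisc, JordanDomain.unitDisc, circleMap]
    rw [show (2 * (Real.pi : ℂ) * 2⁻¹ * Complex.I) = Real.pi * Complex.I by ring]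
    exact Complex.exp_pi_mul_I
  have carrier_eq : DobrushinDomain.unitDisc.carrier = Metric.ball (0 : ℂ) 1 := rfl
  have small_mem : Set.Ioc (0 : ℝ) (1 / 16) ∈ 𝓝[>] (0 : ℝ) := Ioc_mem_nhdsGT (by norm_num)
  /- convergence of the deep mesh points to `1` -/
  have tendsto_deep : Tendsto (fun δ => meshPoint δ ![deepIndex δ, 0]) (𝓝[>] (0 : ℝ)) (𝓝 1) := by
    rw [Metric.tendsto_nhds]
    intro ε hε
    have hmem : Set.Ioo (0 : ℝ) (min (ε ^ 2 / 16) (ε / 4)) ∈ 𝓝[>] (0 : ℝ) :=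
      Ioo_mem_nhdsGT (by positivity)
    filter_upwards [hmem] with δ hδ
    obtain ⟨hδ0, hδ1⟩ := hδ
    have hδa : δ < ε ^ 2 / 16 := hδ1.trans_le (min_le_left _ _)
    have hδb : δ < ε / 4 := hδ1.trans_le (min_le_right _ _)
    have hs : Real.sqrt δ < ε / 4 := by
      calc Real.sqrt δ < Real.sqrt (ε ^ 2 / 16) := Real.sqrt_lt_sqrt hδ0.le hδa
        _ = ε / 4 := by
          rw [show ε ^ 2 / 16 = (ε / 4) ^ 2 by ring, Real.sqrt_sq (by positivity)]
    calc dist (meshPoint δ ![deepIndex δ, 0]) 1 < Real.sqrt δ + 2 * δ := dist_deep_lt hδ0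
      _ < ε := by linarith
  refine ⟨fun δ => ![deepIndex δ, 0], fun δ => ![-deepIndex δ, 0], ⟨?_, ?_, ?_⟩, ?_⟩
  · filter_upwards [small_mem] with δ hδ
    exact reachable_of_mem (deep_mem hδ.1 hδ.2) (deep_neg_mem hδ.1 hδ.2)
  · rw [pt_zero]; exact tendsto_deep
  · rw [pt_one]
    have : (fun δ => meshPoint δ ![-deepIndex δ, 0]) = fun δ => -meshPoint δ ![deepIndex δ, 0] := by
      funext δ; exact meshPoint_neg δ _
    rw [this]
    exact tendsto_deep.neg
  · intro δ hδ hδ' z hz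
    rw [carrier_eq, Metric.mem_ball, dist_zero_right]
    rw [Metric.mem_ball, meshPoint_vec] at hz
    obtain ⟨-, h2⟩ := deepIndex_bounds hδ
    obtain ⟨h3, -⟩ := deepIndex_pos hδ hδ'
    have hp : ‖((δ * (deepIndex δ : ℝ) : ℝ) : ℂ)‖ = δ * (deepIndex δ : ℝ) := by
      rw [Complex.norm_real, Real.norm_eq_abs, abs_of_pos (by linarith)]
    calc ‖z‖ ≤ ‖z - ((δ * (deepIndex δ : ℝ) : ℝ) : ℂ)‖ + ‖((δ * (deepIndex δ : ℝ) : ℝ) : ℂ)‖ :=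
          norm_le_norm_sub_add z _
      _ < Real.sqrt δ + δ * (deepIndex δ : ℝ) := by rw [hp, ← dist_eq_norm]; linarith
      _ < 1 := by linarith

end DeepStart

end Summit.CriticalPhenomena.SAWScalingLimit.Theorems.TPToTraversalBound.Negative
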